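/-
Copyright (c) 2026 the pub-hodgecm-mathlib formalisation cell (harness21).  Prover seat hodgecm-mathlib-F0P3a-p01 (g36), Track A «(D-RAM) FOUR-FRAME» squad, helper lane
on h413 = stmt-HodgeConjecture-24833 (count-neutral).  DEFS LEAF №5 «STAGE-1b» — ITEM №0 of the STAGE-1b directive (heir dealer∕pen LH4-plan (g13) WORD #52 D-1b DRAFT v1
0e9d88fd §1; heir LEAD F0P3a-plan (g20∕g21) T19-31 (R-29)(b) ∕ T19-34).  Single writer; text blocks = the owners' sheets VERBATIM (F0P3a-p01 (g35) (L-lev)-SIG v4 9d4ec256 ∕ scratch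
v6 d357483c; LH4-p12 (g7) (L-sq)-SIG 93c44a1a ∕ scratch v2 c34c0bd0; LH4-p05 (g8) (L-T+) v7; LH4-p06 (g6) (H-lev)-SIG v3 ∕ ★ p859209); letters per heir LEAD T19-35∕36, WORDS #54–#56.  2026-09-04.
-/
import Summits.HodgeConjecture.HodgeConjecture.Theorems.F0P3cDyRamOmegaRDefs                            -- ★ `omegaR`; brings ★ DEFS №1-R2 `OmegaSchedule`, `KappaSignLawAtS2`, ★ №1-R `shiftR`, ★ №1 `DyadicFence`, `StableLawAt`, ★ Lit #0a `ampl`, `depthOfRecord`, `kappaChar`, …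
import Summits.HodgeConjecture.HodgeConjecture.Theorems.F0P3cDyRamFrameEltLevelAlgebra                   -- ★ p858722 (LH4-p12 (g7)): census algebra; brings ★ census DEFS `LatticeInLevel`, `LatticeNearTransvShell`, `LatticeLabelPlus`, `transvPlusFixCount`, `regFixCount`
import Summits.HodgeConjecture.HodgeConjecture.Theorems.F0P3cDyRamPieceRowsLevelsOfFrameSignedCensus     -- ★ p858924 (LH4-p11 (g7)): the (J-lev-frame) sockets; brings ★ p858704 dictionaries, ★ №3 `mstarOfRecord`∕`dOfPlace`∕`InLevel`∕`wMatrix`, the H-side place vocabulary of §5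
import HarnessLib

/-!
# Crux `H413`, line LH4 «(D-RAM) FOUR-FRAME» — DEFS LEAF №5 «STAGE-1b»: the count tokens, level∕exponent schedules, amplitude letters, law Props and H-side triple Props
# in which the tier-0 ED. 5 «TYPED SPLIT BY COMPOSITION» states its six new stubs (one body per name; nothing asserted)

Cell `hodgecm-mathlib` (D-0151), FLOOR 0, crux item H413 = `stmt-HodgeConjecture-24833`, route `HCCMUnconditional`; squads F0∕P3c∕LH4 ∕ F0∕P3a.  DEF LANE (`--kind definition
--supports stmt-HodgeConjecture-24833`): `def`s + `rfl`∕`decide` ties only; no instance, no notation, no `sorry`, default heartbeats; ★ `Theorems` imports only (no `Cruxes.H413.Lines.*`).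

WHY.  The two ★ JUNCTIONS of the open tier-0 rows (LH4-p06 (g6) ★ p859234 `Theorems/F0P3cDyRamTierZeroRowsTwoThreeOfLevels`:
`pieceRowsWild_gselStar_two_of_fencedLaws_of_hsides (shift Ω N₀ Alo Ahi) (hPlus) (hLlo) (hHlo) (hLhi) (hHhi)` ∕ `pieceRowsWild_gselStar_three_of_fencedLaw_of_hside (shift Ω N₀ Asq)
(hUnit) (hL) (hH)`) have DEF-FREE slots: a FENCED κ-signed level-census law (★ №1-R2 `KappaSignLawAtS2 shift Ω N₀` binder block behind `|2| < 1`, count token = the two-level ∕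
square-level fixed type-0 vertex census, amplitude letter `A q d t k B`) and an H-side triple in the law's closed form.  Tier-0 ED. 5 registers SIX stubs = those slots at the tokens
of record, stated BY NAME in this vocabulary (one body per name; owners (L-lev) F0P3a-p01 (g35), (L-sq) LH4-p12 (g7), (L-T+) LH4-p05 (g8), (H-lev)∕(H-sq) LH4-p06 (g6)):
§1 COUNT TOKENS `levFixCount` · `sqFixCount` · `shellFixCount` · `cleanMinusFixCount` (the ★ p858704 ∕ ★ p858722 ∕ ★ census-DEFS set-builders, token for token); §2 SCHEDULES
`ℕ → ℕ` of the datum `d` (`laLowOfRecord = ℓ₀`, `laHighOfRecord`, `csOfRecord`, `klOfRecord`, `blOfRecord`; the ED. 6 letters `mcOfRecord`, `sTOfRecord`, `n0CleanOfRecord` ride now,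
LH4-p05 (g8) 10:39:32Z); §3 AMPLITUDE LETTERS as CLOSED TERMS (`amplCs` — the ONE name of the shared `Alo`∕`Asq` body, T19-35 (r-a), WORD #54 — and `amplLevHi`); §4 LAW
PROPS at one datum (`LevStableLawAt`, `LevKappaSignLawAtS2`, `ShellKappaSignLawAtS2`, `LevLowEqSqAt` · `SqStableLawAt`, `SqKappaSignLawAtS2`, `RegKappaSignLawAtS2`: ★ №1 ∕ ★ №1-R2
binder blocks VERBATIM, count token re-read, `(k, B) ↦ (k − k• d, B − b• d)`, type-0 conjunct, SAME Ω-aware sign token; fence ★ `DyadicFence` applied OUTSIDE); §5 H-SIDE TRIPLE PROPS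
`HSideLevelsTripleS shift Ω N₀ la lb A` ∕ `HSideSqTripleS shift Ω N₀ lb A` := the `hH` binders of ★ p859209 (V-lev) ∕ (V-sq) VERBATIM (LH4-p06 (g6) 10:40:21Z «=»); §6 ties.
EVERY LAW PROP HERE IS A CENSUS LAW ∕ G-SIDE IDENTITY — a PROVER TARGET (FITS (r6) SIGSHEET-1b F1∕F2 40∕40, F3 33∕33 + q = 4; `mc_check`), never a literature fact; nothing asserted.
HONEST LABEL.  Count-neutral (`--supports`): a DEFS leaf pays no row; tier-0 rows T₊ ∕ T₋ ∕ regular OPEN; `HC_CM` is proved only modulo the 7 printed citations (2 remaining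
named inputs: hLiu418 = `stmt-HodgeConjecture-24832`, h413 = `stmt-HodgeConjecture-24833`) until rung 0 closes.

## References
* [Rogawski1990] J. D. Rogawski, *Automorphic Representations of Unitary Groups in Three Variables*, Ann. of Math. Stud. 123 (1990): §4.3 (4.3.1) p. 43; §4.9 Prop. 4.9.1 (a)(b) p. 55, Lemma 4.9.3 p. 56; §8.1 Prop. 8.1.2 (b) p. 114.
* [Kottwitz1986BaseChangeUnits] R. E. Kottwitz, *Base change for unit elements of Hecke algebras*, Compositio Math. 60 (1986), §1 pp. 240–241.
* [LanglandsShelstad1987] R. P. Langlands, D. Shelstad, *On the definition of transfer factors*, Math. Ann. 278 (1987), §1.3, §3.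
-/

set_option autoImplicit false

noncomputable section
namespace Summit.HodgeConjecture.HodgeConjecture.Cruxes.H413.F0P3cDyRamStageOneBDefs

open MeasureTheory Measure NumberField IsDedekindDomain Topology Filter Literature.NumberTheory.Rogawski1990 Literature.NumberTheory.GaloisRepresentations
open Literature.NumberTheory.Automorphic Literature.NumberTheory.Automorphic.UnitaryGroup Literature.NumberTheory.Automorphic.IntegralReduction
  Literature.NumberTheory.Automorphic.UnitaryLatticeTree Literature.NumberTheory.Automorphic.HermitianLattice Literature.NumberTheory.Automorphic.UnitaryThreeFourFrame
open Literature.MeasureTheory.Group (descConj)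
open scoped Matrix MatrixGroups ValuativeRel WithZero
open Summit.HodgeConjecture.HodgeConjecture.Cruxes.H413.F0P3cDyRamFourFrameLawDefs Summit.HodgeConjecture.HodgeConjecture.Cruxes.H413.F0P3cDyRamFourFrameLawDefsR
  Summit.HodgeConjecture.HodgeConjecture.Cruxes.H413.F0P3cDyRamFourFrameLawDefsR2 Summit.HodgeConjecture.HodgeConjecture.Cruxes.H413.F0P3cDyRamFourFrameHSideDefs
  Summit.HodgeConjecture.HodgeConjecture.Cruxes.H413.F0P3cDyRamFourFrameHSideDefsR Summit.HodgeConjecture.HodgeConjecture.Cruxes.H413.F0P3cDyRamFourFrameCensusDefs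
  Summit.HodgeConjecture.HodgeConjecture.Cruxes.H413.F0P3cDyRamFourFramePieces Summit.HodgeConjecture.HodgeConjecture.Cruxes.H413.F0P3cDyRamLevelsPieceCountDictionary

/-! ## §1  The count tokens (fixed TYPE-0 vertices of the lattice tree of `(K³, Φ₃)`; set-builders = ★ p858704's ∕ ★ p858722's ∕ ★ census DEFS', token for token) -/

section Tokens

variable {K : Type} [Field K] [Valued K ℤᵐ⁰]

/-- `levFixCount σ ϖ a b T` — the number of TYPE-0 vertices `M` FIXED by `T` on which `X = T − 1` has the TWO-LEVEL profile `(a, b)`: `X·M ⊆ ϖ^a·M` and `X²·M ⊆ ϖ^b·M`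
(the census of the congruence-profile piece `𝟙_{K_{a,b}}`; ★ p858704 `pieceCountDictionary_levels`'s count set-builder token for token — (L-lev) v6 :48, owner F0P3a-p01).
[cite: Kottwitz1986BaseChangeUnits, §1 pp. 240–241] [cite: Rogawski1990, §4.9 Prop. 4.9.1 (b) p. 55] -/
def levFixCount (σ : K →+* K) (ϖ : K) (a b : ℕ) (T : GL (Fin 3) K) : ℕ :=
  {M : Submodule (Valued.integer K) (Fin 3 → K) | IsVertexLattice σ ϖ ((StdForm.antidiagonal 3).over K) 0 M ∧ mapGL T M = M ∧
      (LatticeInLevel ϖ a ((T : Matrix (Fin 3) (Fin 3) K) - 1) M ∧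
        LatticeInLevel ϖ b (((T : Matrix (Fin 3) (Fin 3) K) - 1) * ((T : Matrix (Fin 3) (Fin 3) K) - 1)) M)}.ncard

/-- `sqFixCount σ ϖ m T` — the number of TYPE-0 vertices `M` FIXED by `T` on which `T − 1` is SQUARE-LEVEL `m`: `(T−1)²·M ⊆ ϖ^m·M` (the census of the square-level piece
`𝟙{u ∈ K : (ι u − 1)² ∈ ϖ^m M₃(𝒪)}`; `regFixCount σ ϖ m T = fixedVertexCount σ ϖ 0 T − sqFixCount σ ϖ m T`, ★ p858722 — (L-sq) v2 :40, owner LH4-p12 (g7)).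
[cite: Kottwitz1986BaseChangeUnits, §1 pp. 240–241] [cite: Rogawski1990, §4.9 Prop. 4.9.1 (b) p. 55] -/
def sqFixCount (σ : K →+* K) (ϖ : K) (m : ℕ) (T : GL (Fin 3) K) : ℕ :=
  {M : Submodule (Valued.integer K) (Fin 3 → K) | IsVertexLattice σ ϖ ((StdForm.antidiagonal 3).over K) 0 M ∧ mapGL T M = M ∧
      LatticeInLevel ϖ m (((T : Matrix (Fin 3) (Fin 3) K) - 1) * ((T : Matrix (Fin 3) (Fin 3) K) - 1)) M}.ncard

/-- `shellFixCount σ ϖ ℓ m T` — the number of TYPE-0 vertices `M` FIXED by `T` on the NEAR-TRANSVECTION SHELL `(ℓ, m)` (`X·M ⊆ ϖ^ℓ M ⊄ ϖ^{ℓ+1} M`, `X²·M ⊆ ϖ^m M`),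
both labels — ★ p858722 `transvPlusFixCount_add_transvMinusFixCount`'s right-hand set-builder token for token (`= transvPlusFixCount + transvMinusFixCount`; (L-lev) v6 :55 —
ED. 6 matter for the derived `T₊` road, riding now). [cite: Kottwitz1986BaseChangeUnits, §1 pp. 240–241] [cite: Rogawski1990, §4.9 Prop. 4.9.1 (b) p. 55] -/
def shellFixCount (σ : K →+* K) (ϖ : K) (ℓ m : ℕ) (T : GL (Fin 3) K) : ℕ :=
  {M : Submodule (Valued.integer K) (Fin 3 → K) | IsVertexLattice σ ϖ ((StdForm.antidiagonal 3).over K) 0 M ∧ mapGL T M = M ∧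
      LatticeNearTransvShell ϖ ℓ m ((T : Matrix (Fin 3) (Fin 3) K) - 1) M}.ncard

/-- `cleanMinusFixCount σ ϖ d ℓ m mc T` — the number of TYPE-0 vertices FIXED by `T` on the CLEAN shell `(ℓ, mc)` that are NOT `LabelPlus` at precision `m` — the engine's class `T−′`
(TEMPLATE-LAWS §2: clean shell = `T+ ⊔ T−′`; ★ `transvMinusFixCount` = `T−′ ⊔ TF ⊔ X` is a DIFFERENT count); (L-T+) v7 :83, owner LH4-p05 (g8) — the token of the ED. 6 Prop (β)
`CleanSgnFrameConstLawAt`, riding now (p05 10:39:32Z). [cite: Rogawski1990, §4.9 Prop. 4.9.1 (b) p. 55] -/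
def cleanMinusFixCount (σ : K →+* K) (ϖ : K) (d ℓ m mc : ℕ) (T : GL (Fin 3) K) : ℕ :=
  {M : Submodule (Valued.integer K) (Fin 3 → K) | IsVertexLattice σ ϖ ((StdForm.antidiagonal 3).over K) 0 M ∧ mapGL T M = M ∧
      LatticeNearTransvShell ϖ ℓ mc ((T : Matrix (Fin 3) (Fin 3) K) - 1) M ∧ ¬ LatticeLabelPlus σ ϖ d m M ((T : Matrix (Fin 3) (Fin 3) K) - 1)}.ncard

end Tokens

/-! ## §2  The schedules of the datum `d` (PARAMETERS `la lb kl bl cs mc …` of the §4 Props; these are their instances of record) -/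

/-- `laLowOfRecord d = ℓ₀ = d % 2` — the FIRST-LEVEL schedule of the LOWER shell half `𝟙_{K_{ℓ₀,m*}}` (★ p858704 `pieceCountDictionary_levels_shellLow`; (L-lev) v6 :63).
[cite: Rogawski1990, §4.9 Prop. 4.9.1 (b) p. 55] -/
def laLowOfRecord (d : ℕ) : ℕ := d % 2

/-- `laHighOfRecord d = ℓ₀ + 1 = d % 2 + 1` — the FIRST-LEVEL schedule of the UPPER shell half `𝟙_{K_{ℓ₀+1,m*}}` (★ p858704 `pieceCountDictionary_levels_shellHigh`; (L-lev) v6 :60).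
[cite: Rogawski1990, §4.9 Prop. 4.9.1 (b) p. 55] -/
def laHighOfRecord (d : ℕ) : ℕ := d % 2 + 1

/-- `csOfRecord d = ⌈d∕2⌉ = (d + 1) ∕ 2` — the EXPONENT (and `B`-) SHIFT of the square-level piece `sq_{m*}` and of the lower half `lev_{ℓ₀,m*}`: unit law at `(k − cs d, B − cs d)`
((L-sq) v2 :46, owner LH4-p12 (g7); F2 40∕40 at d ≤ 3; = ★ p859102's Levi fibre-volume exponent of `sq_{m*}` for every `d`). [cite: Rogawski1990, §4.9 Prop. 4.9.1 (a) p. 55] -/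
def csOfRecord (d : ℕ) : ℕ := (d + 1) / 2

/-- `klOfRecord d = max (d%2+1) d − d∕2 + 1` (= `⌈d∕2⌉ + 1` for `d ≥ 2`) — the EXPONENT SHIFT of the upper two-level census `lev_{ℓ₀+1,m*}` ((L-lev) v6 :72, owner F0P3a-p01: = the
F3 fit `2 + d % 2` on d ≤ 3 (33∕33 + q = 4) and = ★ p859102's Levi fibre-volume exponent of `𝟙_{K_{ℓ₀+1,m*}}` for EVERY `d`; beyond d ≤ 3 a prediction). [cite: Rogawski1990, §4.9 Prop. 4.9.1 (a) p. 55] -/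
def klOfRecord (d : ℕ) : ℕ := max (d % 2 + 1) d - d / 2 + 1

/-- `blOfRecord d = klOfRecord d − 2` — the `B`-SHIFT of the upper two-level census (`= d % 2` at d ≤ 3, F3; (L-lev) v6 :76). [cite: Rogawski1990, §4.9 Prop. 4.9.1 (a) p. 55] -/
def blOfRecord (d : ℕ) : ℕ := klOfRecord d - 2

/-- `mcOfRecord d = 2·⌊(m* + d)∕2⌋` — THE CLEAN SQUARE LEVEL (TEMPLATE-LAWS §2: on the shell `LabelPlus ∨ LabelMinus′ ⟺ X² ∈ ϖ^{m_c}`, by the trace identity; d = 2..5 ↦ 4, 8, 10, 14);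
(L-T+) v7 :123, owner LH4-p05 (g8) — an ED. 6 letter (the `lb` schedule of (T4)(T5)(α′)(β)), riding now. [cite: Rogawski1990, §4.9 Prop. 4.9.1 (b) p. 55] -/
def mcOfRecord (d : ℕ) : ℕ := 2 * ((mstarOfRecord d + d) / 2)

/-- `sTOfRecord d = d − 1 + ℓ₀` — the Levi exponent `s` of the clean LOWER half `lev_{ℓ₀, m_c}` ((L-T+) v7 :134, owner LH4-p05 (g8); = ★ p859102's exponent at `(ℓ₀, m_c)`; the
clean UPPER half has exponent `s + 1` and `B`-shift `s − 1`).  ED. 6 letter, riding now. [cite: Rogawski1990, §4.9 Prop. 4.9.1 (a) p. 55] -/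
def sTOfRecord (d : ℕ) : ℕ := d - 1 + d % 2

/-- `n0CleanOfRecord d` — the near-1 THRESHOLD of the clean-level laws (T4)(T5) and of (α′)(β): `mcOfRecord d ∕ 2 + 2` bumped to the parity of `d` («`2·min nᵢ ≥ m_c + 4`»; 3, 4, 7, 8, 9
at d = 1..5: R-U 16∕16 at 4, R-P (T4) 8∕8 at min nᵢ ≥ 7); (L-lev) v6 :90, owner F0P3a-p01.  ED. 6 letter, riding now. [cite: Rogawski1990, §4.9 Prop. 4.9.1 (a) p. 55] -/
def n0CleanOfRecord (d : ℕ) : ℕ := mcOfRecord d / 2 + 2 + (mcOfRecord d / 2 + 2 + d) % 2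

/-! ## §3  The amplitude letters (`A q d t k B : ℚ`, the junctions' `Alo ∕ Ahi ∕ Asq` slots; CLOSED TERMS, `t`-slot unused) -/

/-- `amplCs q d t k B = ampl q (k − csOfRecord d) (B − csOfRecord d)` — THE SHARED amplitude letter of the SQUARE-LEVEL law (`Asq` slot; (L-sq) F2) AND of the LOWER two-level law
`lev_{ℓ₀,m*}` (`Alo` slot; the lower half IS the square level by (L-lev-0), F1): the unit's ★ `ampl` at exponents shifted by `cs` — ONE NAME PER BODY (heir LEAD T19-35 (r-a) ∕ T19-36 (2);
dealer WORD #54: the token is `amplCs`; `amplLevLo`∕`amplSq` STRUCK). [cite: Rogawski1990, §4.9 Prop. 4.9.1 (a) p. 55] -/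
def amplCs : ℕ → ℕ → ℕ → ℕ → ℤ → ℚ := fun q d _t k B => ampl q (k - csOfRecord d) (B - csOfRecord d)

/-- `amplLevHi q d t k B = ampl q (k − klOfRecord d) (B − blOfRecord d)` — the amplitude letter of the UPPER two-level law `lev_{ℓ₀+1,m*}` (the `Ahi` slot; F3).
[cite: Rogawski1990, §4.9 Prop. 4.9.1 (a) p. 55] -/
def amplLevHi : ℕ → ℕ → ℕ → ℕ → ℤ → ℚ := fun q d _t k B => ampl q (k - klOfRecord d) (B - blOfRecord d)

/-! ## §4  The law Props at one datum (★ №1 `StableLawAt` ∕ ★ №1-R2 `KappaSignLawAtS2` binder blocks VERBATIM, count token re-read, shifted `(k, B)`, type-0 conjunct only;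
the fence ★ `DyadicFence` is applied OUTSIDE: `DyadicFence (K := K) (P … σ ϖ d t)`).  CENSUS LAWS ∕ G-SIDE IDENTITIES — PROVER TARGETS, nothing asserted. -/

/-- (S-lev)-At · THE STABLE TWO-LEVEL CENSUS LAW at one datum: `Σ_b levFixCount (la d) (lb d) (Γ_b) = 4(q^{k − kl d} − 1)∕(q − 1)` — ★ №1 `StableLawAt`, `tv := 0`, shifted
exponent ((L-lev) v6 :100; F3 at `la = laHighOfRecord`, F1+F2 at `la = laLowOfRecord`).  A FIT typed as a PROVER TARGET, nothing asserted. [cite: Rogawski1990, §4.9 Prop. 4.9.1 (a) p. 55] [cite: Kottwitz1986BaseChangeUnits, §1 pp. 240–241] -/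
def LevStableLawAt {K : Type} [Field K] [Valued K ℤᵐ⁰] [CompleteSpace K] [Fintype (Valued.ResidueField K)] (N₀ la lb kl : ℕ → ℕ) (σ : K →+* K) (ϖ : K) (d t : ℕ) : Prop :=
    IsRamifiedQuadraticDatum σ ϖ d t →
    ∀ (f : Fin 4 → Fin 3 → (Fin 3 → K)), IsFourFrameFamily σ f →
    ∀ (α β : K) (n₁ n₂ n₃ : ℕ), IsElementDatum σ ϖ (N₀ d) α β n₁ n₂ n₃ →
    ∀ (Γ : Fin 4 → GL (Fin 3) K), (∀ b, (Γ b : Matrix (Fin 3) (Fin 3) K) = frameElt σ f b α β) →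
    ∀ (k : ℕ), 2 * k + d = n₁ + n₂ + n₃ + 2 →
      ((∑ b : Fin 4, levFixCount σ ϖ (la d) (lb d) (Γ b) : ℕ) : ℚ) =
        4 * ((Fintype.card (Valued.ResidueField K) : ℚ) ^ (k - kl d) - 1) / ((Fintype.card (Valued.ResidueField K) : ℚ) - 1)

/-- (K-SGN-lev)-S2-At · THE κ-SIGNED TWO-LEVEL CENSUS LAW at one datum, tokens scheduled as in ★ №1-R2 (`shift`, `Ω`) plus the level ∕ exponent schedules `la lb kl bl`:
`Σ_b κ_i(b)·levFixCount (la d) (lb d) (Γ_b) = Ω·baseSign_i·ω(fPartProd) · ampl q (k − kl d) (B − bl d)` ((L-lev) v6 :112; F3 33∕33 + q = 4 at the upper instance, F1+F2 at the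
lower; sign token READ, not derived).  ℕ-CORNER (dealer WORD #55 (j1)): behind ★ `DyadicFence` a ramified quadratic datum is WILD, so `2 ≤ d` at every reachable instance — the one
truncating cell of `k − kl d` (`d = 1`, `k = 2 < klOfRecord 1 = 3`) is vacuous.  A FIT typed as a PROVER TARGET, nothing asserted. [cite: Rogawski1990, §4.9 Prop. 4.9.1 (a) p. 55] [cite: LanglandsShelstad1987, §1.3, §3] -/
def LevKappaSignLawAtS2 {K : Type} [Field K] [Valued K ℤᵐ⁰] [CompleteSpace K] [Fintype (Valued.ResidueField K)] (shift : ℕ → ℕ → ℤ) (Ω : OmegaSchedule) (N₀ la lb kl bl : ℕ → ℕ)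
    (σ : K →+* K) (ϖ : K) (d t : ℕ) : Prop :=
    IsRamifiedQuadraticDatum σ ϖ d t →
    ∀ (f : Fin 4 → Fin 3 → (Fin 3 → K)), IsFourFrameFamily σ f →
    ∀ (δ : K), σ δ = -δ → δ ≠ 0 →
    ∀ (a b : K), a * σ a = 1 → b * σ b = 1 → Valued.v (a - 1) < Valued.v (2 : K) → Valued.v (b - 1) < Valued.v (2 : K) →
    ∀ (n₁ n₂ n₃ : ℕ), IsElementDatum σ ϖ (N₀ d) (a * a) (b * b) n₁ n₂ n₃ →
    ∀ (Γ : Fin 4 → GL (Fin 3) K), (∀ b', (Γ b' : Matrix (Fin 3) (Fin 3) K) = frameElt σ f b' (a * a) (b * b)) →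
    ∀ (k : ℕ), 2 * k + d = n₁ + n₂ + n₃ + 2 →
    ∀ (i : Fin 3) (B : ℤ), 2 * B = ((![n₁, n₂, n₃] : Fin 3 → ℕ) i : ℤ) - d + 2 - 2 * shift d t →
      ((∑ b' : Fin 4, kappaChar i b' * (levFixCount σ ϖ (la d) (lb d) (Γ b') : ℤ) : ℤ) : ℚ) =
          (Ω K σ ϖ d a b i * (baseSign σ i * normSign σ (fPartProd δ ![a, b, 1] i)) : ℤ) * ampl (Fintype.card (Valued.ResidueField K)) (k - kl d) (B - bl d)

/-- (K-SGN-shell)-S2-At · THE κ-SIGNED SHELL CENSUS LAW at one datum — the DIFFERENCE shape (`𝟙{K ∩ shell_{la,lb}} = 𝟙_{K_{la,lb}} − 𝟙_{K_{la+1,lb}}`, ★ p858649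
`shell_eq_levels_sub`): `Σ_b κ_i(b)·shellFixCount (la d) (lb d) (Γ_b) = Ω·baseSign_i·ω(fPartProd) · (ampl q (k − k₁ d) (B − b₁ d) − ampl q (k − k₂ d) (B − b₂ d))`
((L-lev) v6 :128; DERIVED from the two (K-SGN-lev) laws at `la` and `la + 1`, not a separate fit; ED. 6 matter, riding now).  PROVER TARGET shape, nothing asserted.
[cite: Rogawski1990, §4.9 Prop. 4.9.1 (a)(b) p. 55] [cite: LanglandsShelstad1987, §1.3, §3] -/
def ShellKappaSignLawAtS2 {K : Type} [Field K] [Valued K ℤᵐ⁰] [CompleteSpace K] [Fintype (Valued.ResidueField K)] (shift : ℕ → ℕ → ℤ) (Ω : OmegaSchedule)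
    (N₀ la lb k₁ b₁ k₂ b₂ : ℕ → ℕ) (σ : K →+* K) (ϖ : K) (d t : ℕ) : Prop :=
    IsRamifiedQuadraticDatum σ ϖ d t →
    ∀ (f : Fin 4 → Fin 3 → (Fin 3 → K)), IsFourFrameFamily σ f →
    ∀ (δ : K), σ δ = -δ → δ ≠ 0 →
    ∀ (a b : K), a * σ a = 1 → b * σ b = 1 → Valued.v (a - 1) < Valued.v (2 : K) → Valued.v (b - 1) < Valued.v (2 : K) →
    ∀ (n₁ n₂ n₃ : ℕ), IsElementDatum σ ϖ (N₀ d) (a * a) (b * b) n₁ n₂ n₃ →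
    ∀ (Γ : Fin 4 → GL (Fin 3) K), (∀ b', (Γ b' : Matrix (Fin 3) (Fin 3) K) = frameElt σ f b' (a * a) (b * b)) →
    ∀ (k : ℕ), 2 * k + d = n₁ + n₂ + n₃ + 2 →
    ∀ (i : Fin 3) (B : ℤ), 2 * B = ((![n₁, n₂, n₃] : Fin 3 → ℕ) i : ℤ) - d + 2 - 2 * shift d t →
      ((∑ b' : Fin 4, kappaChar i b' * (shellFixCount σ ϖ (la d) (lb d) (Γ b') : ℤ) : ℤ) : ℚ) =
          (Ω K σ ϖ d a b i * (baseSign σ i * normSign σ (fPartProd δ ![a, b, 1] i)) : ℤ) *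
            (ampl (Fintype.card (Valued.ResidueField K)) (k - k₁ d) (B - b₁ d) - ampl (Fintype.card (Valued.ResidueField K)) (k - k₂ d) (B - b₂ d))

/-- (L-lev-0)-At · THE LOWER HALF IS THE SQUARE LEVEL, frame by frame: at a wild datum and a four-frame literal `Γ_b`, EVERY fixed type-0 vertex with `X²·M ⊆ ϖ^{m*}M` already
has `X·M ⊆ ϖ^{ℓ₀}M` — `levFixCount (d % 2) m* (Γ_b) = sqFixCount m* (Γ_b)` ((L-lev) v6 :145, right-hand set-builder now NAMED `sqFixCount`, same term; F1 40∕40 + q = 4; the half `d` even is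
★ `F0P3cDyRamLevelsZeroEqSqLevel`, the content is at `d` odd).  G-SIDE IDENTITY — a PROVER TARGET, nothing asserted. [cite: Kottwitz1986BaseChangeUnits, §1 pp. 240–241] [cite: Rogawski1990, §4.9 Prop. 4.9.1 (b) p. 55] -/
def LevLowEqSqAt {K : Type} [Field K] [Valued K ℤᵐ⁰] (N₀ : ℕ → ℕ) (σ : K →+* K) (ϖ : K) (d t : ℕ) : Prop :=
    IsRamifiedQuadraticDatum σ ϖ d t →
    ∀ (f : Fin 4 → Fin 3 → (Fin 3 → K)), IsFourFrameFamily σ f →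
    ∀ (α β : K) (n₁ n₂ n₃ : ℕ), IsElementDatum σ ϖ (N₀ d) α β n₁ n₂ n₃ →
    ∀ (Γ : Fin 4 → GL (Fin 3) K), (∀ b, (Γ b : Matrix (Fin 3) (Fin 3) K) = frameElt σ f b α β) →
    ∀ (b : Fin 4), levFixCount σ ϖ (d % 2) (mstarOfRecord d) (Γ b) = sqFixCount σ ϖ (mstarOfRecord d) (Γ b)

/-- (S-sq)-At · THE STABLE SQUARE-LEVEL CENSUS LAW at one datum: `Σ_b sqFixCount m* (Γ_b) = 4(q^{k − cs d} − 1)∕(q − 1)` — ★ №1 `StableLawAt` at the shifted exponent, type 0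
((L-sq) v2 :55, owner LH4-p12 (g7); SIGSHEET-1b F2 40∕40).  A FIT typed as a PROVER TARGET, nothing asserted. [cite: Rogawski1990, §4.9 Prop. 4.9.1 (a) p. 55] [cite: Kottwitz1986BaseChangeUnits, §1 pp. 240–241] -/
def SqStableLawAt {K : Type} [Field K] [Valued K ℤᵐ⁰] [CompleteSpace K] [Fintype (Valued.ResidueField K)] (N₀ : ℕ → ℕ) (cs : ℕ → ℕ) (σ : K →+* K) (ϖ : K) (d t : ℕ) : Prop :=
    IsRamifiedQuadraticDatum σ ϖ d t →
    ∀ (f : Fin 4 → Fin 3 → (Fin 3 → K)), IsFourFrameFamily σ f →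
    ∀ (α β : K) (n₁ n₂ n₃ : ℕ), IsElementDatum σ ϖ (N₀ d) α β n₁ n₂ n₃ →
    ∀ (Γ : Fin 4 → GL (Fin 3) K), (∀ b, (Γ b : Matrix (Fin 3) (Fin 3) K) = frameElt σ f b α β) →
    ∀ (k : ℕ), 2 * k + d = n₁ + n₂ + n₃ + 2 →
      ((∑ b : Fin 4, sqFixCount σ ϖ (mstarOfRecord d) (Γ b) : ℕ) : ℚ) =
        4 * ((Fintype.card (Valued.ResidueField K) : ℚ) ^ (k - cs d) - 1) / ((Fintype.card (Valued.ResidueField K) : ℚ) - 1)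

/-- (K-SGN-sq)-S2-At · THE κ-SIGNED SQUARE-LEVEL CENSUS LAW at one datum, both tokens scheduled as in ★ №1-R2 (`shift`, `Ω`) plus the exponent shift `cs`:
`Σ_b κ_i(b)·sqFixCount m* (Γ_b) = Ω·baseSign_i·ω(fPartProd) · ampl q (k − cs d) (B − cs d)` ((L-sq) v2 :66, owner LH4-p12 (g7); F2 40∕40, sign token READ).  A FIT typed as a
PROVER TARGET, nothing asserted. [cite: Rogawski1990, §4.9 Prop. 4.9.1 (a) p. 55] [cite: LanglandsShelstad1987, §1.3, §3] -/
def SqKappaSignLawAtS2 {K : Type} [Field K] [Valued K ℤᵐ⁰] [CompleteSpace K] [Fintype (Valued.ResidueField K)] (shift : ℕ → ℕ → ℤ) (Ω : OmegaSchedule) (N₀ : ℕ → ℕ) (cs : ℕ → ℕ)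
    (σ : K →+* K) (ϖ : K) (d t : ℕ) : Prop :=
    IsRamifiedQuadraticDatum σ ϖ d t →
    ∀ (f : Fin 4 → Fin 3 → (Fin 3 → K)), IsFourFrameFamily σ f →
    ∀ (δ : K), σ δ = -δ → δ ≠ 0 →
    ∀ (a b : K), a * σ a = 1 → b * σ b = 1 → Valued.v (a - 1) < Valued.v (2 : K) → Valued.v (b - 1) < Valued.v (2 : K) →
    ∀ (n₁ n₂ n₃ : ℕ), IsElementDatum σ ϖ (N₀ d) (a * a) (b * b) n₁ n₂ n₃ →
    ∀ (Γ : Fin 4 → GL (Fin 3) K), (∀ b', (Γ b' : Matrix (Fin 3) (Fin 3) K) = frameElt σ f b' (a * a) (b * b)) →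
    ∀ (k : ℕ), 2 * k + d = n₁ + n₂ + n₃ + 2 →
    ∀ (i : Fin 3) (B : ℤ), 2 * B = ((![n₁, n₂, n₃] : Fin 3 → ℕ) i : ℤ) - d + 2 - 2 * shift d t →
      ((∑ b' : Fin 4, kappaChar i b' * (sqFixCount σ ϖ (mstarOfRecord d) (Γ b') : ℤ) : ℤ) : ℚ) =
          (Ω K σ ϖ d a b i * (baseSign σ i * normSign σ (fPartProd δ ![a, b, 1] i)) : ℤ) * ampl (Fintype.card (Valued.ResidueField K)) (k - cs d) (B - cs d)

/-- (K-SGN-reg)-S2-At · THE κ-SIGNED REGULAR-PIECE CENSUS LAW at one datum — the DIFFERENCE shape (`f_reg = 1_K − sq_{m*}`):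
`Σ_b κ_i(b)·regFixCount m* (Γ_b) = Ω·baseSign_i·ω(fPartProd) · (ampl q k B − ampl q (k − cs d) (B − cs d))` ((L-sq) v2 :81, owner LH4-p12 (g7); F4, DERIVED from the unit law of record
+ (K-SGN-sq) by ★ p858960, not a separate fit).  PROVER TARGET shape, nothing asserted. [cite: Rogawski1990, §4.9 Prop. 4.9.1 (a)(b) p. 55] [cite: LanglandsShelstad1987, §1.3, §3] -/
def RegKappaSignLawAtS2 {K : Type} [Field K] [Valued K ℤᵐ⁰] [CompleteSpace K] [Fintype (Valued.ResidueField K)] (shift : ℕ → ℕ → ℤ) (Ω : OmegaSchedule) (N₀ : ℕ → ℕ) (cs : ℕ → ℕ)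
    (σ : K →+* K) (ϖ : K) (d t : ℕ) : Prop :=
    IsRamifiedQuadraticDatum σ ϖ d t →
    ∀ (f : Fin 4 → Fin 3 → (Fin 3 → K)), IsFourFrameFamily σ f →
    ∀ (δ : K), σ δ = -δ → δ ≠ 0 →
    ∀ (a b : K), a * σ a = 1 → b * σ b = 1 → Valued.v (a - 1) < Valued.v (2 : K) → Valued.v (b - 1) < Valued.v (2 : K) →
    ∀ (n₁ n₂ n₃ : ℕ), IsElementDatum σ ϖ (N₀ d) (a * a) (b * b) n₁ n₂ n₃ →
    ∀ (Γ : Fin 4 → GL (Fin 3) K), (∀ b', (Γ b' : Matrix (Fin 3) (Fin 3) K) = frameElt σ f b' (a * a) (b * b)) →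
    ∀ (k : ℕ), 2 * k + d = n₁ + n₂ + n₃ + 2 →
    ∀ (i : Fin 3) (B : ℤ), 2 * B = ((![n₁, n₂, n₃] : Fin 3 → ℕ) i : ℤ) - d + 2 - 2 * shift d t →
      ((∑ b' : Fin 4, kappaChar i b' * (regFixCount σ ϖ (mstarOfRecord d) (Γ b') : ℤ) : ℤ) : ℚ) =
          (Ω K σ ϖ d a b i * (baseSign σ i * normSign σ (fPartProd δ ![a, b, 1] i)) : ℤ) *
            (ampl (Fintype.card (Valued.ResidueField K)) k B - ampl (Fintype.card (Valued.ResidueField K)) (k - cs d) (B - cs d))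

/-! ## §5  The H-side triple Props (the `hH` binders of ★ p859209 (V-lev) ∕ (V-sq) VERBATIM; place currency; row (1) in the law's closed form, rows (2)(3) transfer-shaped) -/

open scoped Classical in
/-- (H-lev)-S · **`HSideLevelsTripleS shift Ω N₀ la lb A`** — THE H-SIDE TRIPLE OF THE LEVEL PIECE `𝟙_{K_{la(d), lb(d)}}` in the closed form of its (K-SGN-lev) law with amplitude
letter `A`: at every wild ramified non-split CM place `w ∣ v` with its datum `(ϖ, d, t_E)`, ONE smooth H-family `ψ` with coefficients `coef` such that ROW (1) near 1 on G-regular `γH`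
the combination `Σ_s coef_s·SO_{γH}(ψ_s)` equals `Δ‴(γH, tb 0)·νG₃(K)·((Ω·baseSign·normSign : ℤ) : ℂ)·((A q_w d t_E k B : ℚ) : ℂ)` on every four-frame norm-pair packet, ROW (2) (type (2):
no eigenvalue of `γH` in `L_w`) and ROW (3) (Levi) it equals the κ-orbital sum of the piece — the `hH` binder of ★ p859209 `pieceRowsWild_levels_of_fencedLaw_of_hside shift Ω N₀ la lb A`
TOKEN FOR TOKEN (LH4-p06 (g6) (H-lev)-SIG v3; in keeping with ★ `HSideAnchorRowsS`).  Instances of record `(la, lb, A) = (laLowOfRecord, mstarOfRecord, amplCs)`, `(laHighOfRecord,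
mstarOfRecord, amplLevHi)`.  PAYER (D-1b §3): LH4-p06 (g6) `hSideLevels_hFamily_of_rows` (★ p859526; `ψ := hFamily`, `coef := coefAffine`) fed by the organs LH4-p07 (g8) (row (2), type-(2)
census) and LH4-p08 (g7) (row (3), ★ `LevelsLeviRow`).  NON-VACUITY: not inhabited by `ψ = 0` ∕ degenerate `coef` — rows (2)(3) pin `Σ_s coef_s·SO(ψ_s)` to the κ-orbital sum of the piece,
non-zero near 1 (REF5 R5-277 (iii) probe: the empty family leaves all three rows open).  An H-SIDE IDENTITY — a PROVER TARGET, nothing asserted.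
[cite: Rogawski1990, §4.3 (4.3.1) p. 43; §4.9 Prop. 4.9.1 (a)(b) p. 55; §8.1 Prop. 8.1.2 (b) p. 114] [cite: LanglandsShelstad1987, §1.3, §3] [cite: Kottwitz1986BaseChangeUnits, §1 pp. 240–241] -/
def HSideLevelsTripleS (shift : ℕ → ℕ → ℤ) (Ω : OmegaSchedule) (N₀ la lb : ℕ → ℕ) (A : ℕ → ℕ → ℕ → ℕ → ℤ → ℚ) : Prop :=
    ∀ (L : Type) [Field L] [NumberField L] [IsCMField L]
      {v : HeightOneSpectrum (𝓞 ↥(maximalRealSubfield L))} (w : UnitaryGroup.PlacesOver L v)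
      (hw : IsCMField.complexConj L • w.1 = w.1) (_he : v.asIdeal.ramificationIdx' w.1.asIdeal ≠ 1)
      (_h2 : ¬ IsUnit (2 : 𝒪[w.1.adicCompletion L]))
      (ϖ : (w.1.adicCompletion L)) (_hϖ : Valued.v ϖ = WithZero.exp (-1 : ℤ)) (d tE : ℕ) (_hD : IsRamifiedQuadraticDatum (galAdicCompletionMap (L := L) (IsCMField.complexConj L) hw) ϖ d tE)
      [Fintype (Valued.ResidueField (w.1.adicCompletion L))] (δ : (w.1.adicCompletion L)) (_hδ : (galAdicCompletionMap (L := L) (IsCMField.complexConj L) hw) δ = -δ) (_hδ0 : δ ≠ 0)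
      (μ : HeckeCharacter L) (_hμu : μ.IsUnitary)
      (_hμω : ∀ x : ideleGroup ↥(maximalRealSubfield L), μ (AdeleRing.ideleBaseChange ↥(maximalRealSubfield L) L x) = quadraticHeckeCharCM L x)
      [MeasurableSpace ((UnitaryGroup.cmDatum L 3 (Matrix.of fun i j : Fin 3 => if i.val + j.val + 1 = 3 then (1 : L) else 0)).Local v)] [BorelSpace ((UnitaryGroup.cmDatum L 3 (Matrix.of fun i j : Fin 3 => if i.val + j.val + 1 = 3 then (1 : L) else 0)).Local v)]
      [∀ γ : ((UnitaryGroup.cmDatum L 3 (Matrix.of fun i j : Fin 3 => if i.val + j.val + 1 = 3 then (1 : L) else 0)).Local v), MeasurableSpace (((UnitaryGroup.cmDatum L 3 (Matrix.of fun i j : Fin 3 => if i.val + j.val + 1 = 3 then (1 : L) else 0)).Local v) ⧸ Subgroup.centralizer ({γ} : Set ((UnitaryGroup.cmDatum L 3 (Matrix.of fun i j : Fin 3 => if i.val + j.val + 1 = 3 then (1 : L) else 0)).Local v)))]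
      [∀ γ : ((UnitaryGroup.cmDatum L 3 (Matrix.of fun i j : Fin 3 => if i.val + j.val + 1 = 3 then (1 : L) else 0)).Local v), BorelSpace (((UnitaryGroup.cmDatum L 3 (Matrix.of fun i j : Fin 3 => if i.val + j.val + 1 = 3 then (1 : L) else 0)).Local v) ⧸ Subgroup.centralizer ({γ} : Set ((UnitaryGroup.cmDatum L 3 (Matrix.of fun i j : Fin 3 => if i.val + j.val + 1 = 3 then (1 : L) else 0)).Local v)))]
      [MeasurableSpace ((UnitaryGroup.cmDatum L 2 (Matrix.of fun i j : Fin 2 => if i.val + j.val + 1 = 2 then (1 : L) else 0)).Local v × (UnitaryGroup.cmDatum L 1 (Matrix.of fun i j : Fin 1 => if i.val + j.val + 1 = 1 then (1 : L) else 0)).Local v)] [BorelSpace ((UnitaryGroup.cmDatum L 2 (Matrix.of fun i j : Fin 2 => if i.val + j.val + 1 = 2 then (1 : L) else 0)).Local v × (UnitaryGroup.cmDatum L 1 (Matrix.of fun i j : Fin 1 => if i.val + j.val + 1 = 1 then (1 : L) else 0)).Local v)]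
      [∀ a : ((UnitaryGroup.cmDatum L 2 (Matrix.of fun i j : Fin 2 => if i.val + j.val + 1 = 2 then (1 : L) else 0)).Local v × (UnitaryGroup.cmDatum L 1 (Matrix.of fun i j : Fin 1 => if i.val + j.val + 1 = 1 then (1 : L) else 0)).Local v), MeasurableSpace (((UnitaryGroup.cmDatum L 2 (Matrix.of fun i j : Fin 2 => if i.val + j.val + 1 = 2 then (1 : L) else 0)).Local v × (UnitaryGroup.cmDatum L 1 (Matrix.of fun i j : Fin 1 => if i.val + j.val + 1 = 1 then (1 : L) else 0)).Local v) ⧸ Subgroup.centralizer ({a} : Set ((UnitaryGroup.cmDatum L 2 (Matrix.of fun i j : Fin 2 => if i.val + j.val + 1 = 2 then (1 : L) else 0)).Local v × (UnitaryGroup.cmDatum L 1 (Matrix.of fun i j : Fin 1 => if i.val + j.val + 1 = 1 then (1 : L) else 0)).Local v)))]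
      [∀ a : ((UnitaryGroup.cmDatum L 2 (Matrix.of fun i j : Fin 2 => if i.val + j.val + 1 = 2 then (1 : L) else 0)).Local v × (UnitaryGroup.cmDatum L 1 (Matrix.of fun i j : Fin 1 => if i.val + j.val + 1 = 1 then (1 : L) else 0)).Local v), BorelSpace (((UnitaryGroup.cmDatum L 2 (Matrix.of fun i j : Fin 2 => if i.val + j.val + 1 = 2 then (1 : L) else 0)).Local v × (UnitaryGroup.cmDatum L 1 (Matrix.of fun i j : Fin 1 => if i.val + j.val + 1 = 1 then (1 : L) else 0)).Local v) ⧸ Subgroup.centralizer ({a} : Set ((UnitaryGroup.cmDatum L 2 (Matrix.of fun i j : Fin 2 => if i.val + j.val + 1 = 2 then (1 : L) else 0)).Local v × (UnitaryGroup.cmDatum L 1 (Matrix.of fun i j : Fin 1 => if i.val + j.val + 1 = 1 then (1 : L) else 0)).Local v)))]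
      (νH : Measure ((UnitaryGroup.cmDatum L 2 (Matrix.of fun i j : Fin 2 => if i.val + j.val + 1 = 2 then (1 : L) else 0)).Local v × (UnitaryGroup.cmDatum L 1 (Matrix.of fun i j : Fin 1 => if i.val + j.val + 1 = 1 then (1 : L) else 0)).Local v)) [νH.IsHaarMeasure] [νH.IsMulRightInvariant]
      (νG₃ : Measure ((UnitaryGroup.cmDatum L 3 (Matrix.of fun i j : Fin 3 => if i.val + j.val + 1 = 3 then (1 : L) else 0)).Local v)) [νG₃.IsHaarMeasure] [νG₃.IsMulRightInvariant]
      (mH : OrbitalMeasureFamily ((UnitaryGroup.cmDatum L 2 (Matrix.of fun i j : Fin 2 => if i.val + j.val + 1 = 2 then (1 : L) else 0)).Local v × (UnitaryGroup.cmDatum L 1 (Matrix.of fun i j : Fin 1 => if i.val + j.val + 1 = 1 then (1 : L) else 0)).Local v)) (mG₃ : OrbitalMeasureFamily ((UnitaryGroup.cmDatum L 3 (Matrix.of fun i j : Fin 3 => if i.val + j.val + 1 = 3 then (1 : L) else 0)).Local v))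
      (_hmH : mH.IsCanonical (IsLocalGRegular L v) νH) (_hmG : mG₃.IsCanonical (fun γ => IsRegularElt (γ.val : GL (Fin 3) (UnitaryGroup.LocalRing L v))) νG₃),
      ∃ (r : ℕ) (ψ : Fin r → ((UnitaryGroup.cmDatum L 2 (Matrix.of fun i j : Fin 2 => if i.val + j.val + 1 = 2 then (1 : L) else 0)).Local v × (UnitaryGroup.cmDatum L 1 (Matrix.of fun i j : Fin 1 => if i.val + j.val + 1 = 1 then (1 : L) else 0)).Local v) → ℂ) (_ : ∀ s, IsLocSmooth (ψ s)) (coef : Fin r → ℂ),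
        -- ROW (1): the H-side realises THE κ-SIGNED LEVEL CENSUS OVER THE FOUR FRAMES `Γ_b` times the base transfer factor (no law pre-evaluated)
        (∃ V ∈ 𝓝 (1 : ((UnitaryGroup.cmDatum L 2 (Matrix.of fun i j : Fin 2 => if i.val + j.val + 1 = 2 then (1 : L) else 0)).Local v × (UnitaryGroup.cmDatum L 1 (Matrix.of fun i j : Fin 1 => if i.val + j.val + 1 = 1 then (1 : L) else 0)).Local v)), ∀ γH ∈ V, IsLocalGRegular L v γH →
          ∀ (f : Fin 4 → Fin 3 → (Fin 3 → (w.1.adicCompletion L))) (_hf : IsFourFrameFamily (galAdicCompletionMap (L := L) (IsCMField.complexConj L) hw) f)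
        (a b z : (w.1.adicCompletion L)) (_ha : a * (galAdicCompletionMap (L := L) (IsCMField.complexConj L) hw) a = 1) (_hb : b * (galAdicCompletionMap (L := L) (IsCMField.complexConj L) hw) b = 1) (_hz : z * (galAdicCompletionMap (L := L) (IsCMField.complexConj L) hw) z = 1)
        (_hzγ : z = finGammaTwo L v γH w) (_hra : ((((γH).1.val : GL (Fin 2) (UnitaryGroup.LocalRing L v)).val.map (Pi.evalRingHom (fun w' : UnitaryGroup.PlacesOver L v => w'.1.adicCompletion L) w))).charpoly.IsRoot (z * (a * a))) (_hrb : ((((γH).1.val : GL (Fin 2) (UnitaryGroup.LocalRing L v)).val.map (Pi.evalRingHom (fun w' : UnitaryGroup.PlacesOver L v => w'.1.adicCompletion L) w))).charpoly.IsRoot (z * (b * b)))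
        (_ha1 : Valued.v (a - 1) < Valued.v (2 : (w.1.adicCompletion L))) (_hb1 : Valued.v (b - 1) < Valued.v (2 : (w.1.adicCompletion L)))
        (n₁ n₂ n₃ : ℕ) (_hE : IsElementDatum (galAdicCompletionMap (L := L) (IsCMField.complexConj L) hw) ϖ (N₀ d) (a * a) (b * b) n₁ n₂ n₃)
        (k : ℕ) (_hk : 2 * k + d = n₁ + n₂ + n₃ + 2)
        (Γ : Fin 4 → GL (Fin 3) (w.1.adicCompletion L)) (_hΓ : ∀ b', (Γ b' : Matrix (Fin 3) (Fin 3) (w.1.adicCompletion L)) = frameElt (galAdicCompletionMap (L := L) (IsCMField.complexConj L) hw) f b' (a * a) (b * b))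
        (tb : Fin 4 → ((UnitaryGroup.cmDatum L 3 (Matrix.of fun i j : Fin 3 => if i.val + j.val + 1 = 3 then (1 : L) else 0)).Local v)) (_htb : ∀ b', ((((localNonsplitEquiv (IsCMField.complexConj L) (Matrix.of fun i j : Fin 3 => if i.val + j.val + 1 = 3 then (1 : L) else 0) (IsCMField.complexConj_ne_one L) w hw (tb b') :
              ↥(unitaryGroupOfForm (galAdicCompletionMap (L := L) (IsCMField.complexConj L) hw) (placeForm (Matrix.of fun i j : Fin 3 => if i.val + j.val + 1 = 3 then (1 : L) else 0) w.1))) : GL (Fin 3) (w.1.adicCompletion L)) : Matrix (Fin 3) (Fin 3) (w.1.adicCompletion L))) = z • (Γ b' : Matrix (Fin 3) (Fin 3) (w.1.adicCompletion L)))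
            (i : Fin 3) (B : ℤ), 2 * B = ((![n₁, n₂, n₃] : Fin 3 → ℕ) i : ℤ) - d + 2 - 2 * shift d tE →
            (∀ t' : ((UnitaryGroup.cmDatum L 3 (Matrix.of fun i j : Fin 3 => if i.val + j.val + 1 = 3 then (1 : L) else 0)).Local v), IsLocalNormPair L (Matrix.of fun i j : Fin 3 => if i.val + j.val + 1 = 3 then (1 : L) else 0) v γH t' ↔ ∃ b', ConjClasses.mk t' = ConjClasses.mk (tb b')) →
            (∀ b' : Fin 4, ((finExplicitCollection L (Matrix.of fun i j : Fin 3 => if i.val + j.val + 1 = 3 then (1 : L) else 0) μ (finExplicitDelta_conj_left_all L (Matrix.of fun i j : Fin 3 => if i.val + j.val + 1 = 3 then (1 : L) else 0) μ) (finExplicitDelta_conj_right_all L (Matrix.of fun i j : Fin 3 => if i.val + j.val + 1 = 3 then (1 : L) else 0) μ)) v).Δ γH (tb b') = ((finExplicitCollection L (Matrix.of fun i j : Fin 3 => if i.val + j.val + 1 = 3 then (1 : L) else 0) μ (finExplicitDelta_conj_left_all L (Matrix.of fun i j : Fin 3 => if i.val + j.val + 1 = 3 then (1 : L) else 0) μ)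 (finExplicitDelta_conj_right_all L (Matrix.of fun i j : Fin 3 => if i.val + j.val + 1 = 3 then (1 : L) else 0) μ)) v).Δ γH (tb 0) * (kappaChar i b' : ℂ)) →
            ∑ s, coef s * stableOrbitalIntegralRel (IsLocalStablyConjH L v) mH (ψ s) γH =
              ((finExplicitCollection L (Matrix.of fun i j : Fin 3 => if i.val + j.val + 1 = 3 then (1 : L) else 0) μ (finExplicitDelta_conj_left_all L (Matrix.of fun i j : Fin 3 => if i.val + j.val + 1 = 3 then (1 : L) else 0) μ) (finExplicitDelta_conj_right_all L (Matrix.of fun i j : Fin 3 => if i.val + j.val + 1 = 3 then (1 : L) else 0) μ)) v).Δ γH (tb 0) * ((νG₃ (cmLocalIntegralLevel L 3 (Matrix.of fun i j : Fin 3 => if i.val + j.val + 1 = 3 then (1 : L) else 0) v : Set ((UnitaryGroup.cmDatum L 3 (Matrix.of fun i j : Fin 3 => if i.val + j.val + 1 = 3 then (1 : L) else 0)).Local v))).toReal : ℂ) *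
                (((Ω (w.1.adicCompletion L) (galAdicCompletionMap (L := L) (IsCMField.complexConj L) hw) ϖ d a b i * (baseSign (galAdicCompletionMap (L := L) (IsCMField.complexConj L) hw) i * normSign (galAdicCompletionMap (L := L) (IsCMField.complexConj L) hw) (fPartProd δ ![a, b, 1] i)) : ℤ) : ℂ) *
                  ((A (Fintype.card (Valued.ResidueField (w.1.adicCompletion L))) d tE k B : ℚ) : ℂ))) ∧
        -- ROW (2), type (2), transfer-shaped (law debt)
        (∃ V ∈ 𝓝 (1 : ((UnitaryGroup.cmDatum L 2 (Matrix.of fun i j : Fin 2 => if i.val + j.val + 1 = 2 then (1 : L) else 0)).Local v × (UnitaryGroup.cmDatum L 1 (Matrix.of fun i j : Fin 1 => if i.val + j.val + 1 = 1 then (1 : L) else 0)).Local v)), ∀ γH ∈ V, IsLocalGRegular L v γH →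
        ¬ (∃ x : (w.1.adicCompletion L), (((((γH).1.val : GL (Fin 2) (UnitaryGroup.LocalRing L v)).val.map (Pi.evalRingHom (fun w' : UnitaryGroup.PlacesOver L v => w'.1.adicCompletion L) w))).charpoly).IsRoot x) →
        ∑ᶠ c : ConjClasses ((UnitaryGroup.cmDatum L 3 (Matrix.of fun i j : Fin 3 => if i.val + j.val + 1 = 3 then (1 : L) else 0)).Local v), ((finExplicitCollection L (Matrix.of fun i j : Fin 3 => if i.val + j.val + 1 = 3 then (1 : L) else 0) μ (finExplicitDelta_conj_left_all L (Matrix.of fun i j : Fin 3 => if i.val + j.val + 1 = 3 then (1 : L) else 0) μ) (finExplicitDelta_conj_right_all L (Matrix.of fun i j : Fin 3 => if i.val + j.val + 1 = 3 then (1 : L) else 0) μ)) v).Δ γH (Quotient.out c) * classOrbitalIntegral mG₃ 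
          (Set.indicator {u : ((UnitaryGroup.cmDatum L 3 (Matrix.of fun i j : Fin 3 => if i.val + j.val + 1 = 3 then (1 : L) else 0)).Local v) |
          u ∈ cmLocalIntegralLevel L 3 (Matrix.of fun i j : Fin 3 => if i.val + j.val + 1 = 3 then (1 : L) else 0) v ∧
          (InLevel ϖ (la (dOfPlace L v w)) (wMatrix L w hw u - 1) ∧ InLevel ϖ (lb (dOfPlace L v w)) ((wMatrix L w hw u - 1) * (wMatrix L w hw u - 1)))} (fun _ => (1 : ℂ))) c =
          ∑ s, coef s * stableOrbitalIntegralRel (IsLocalStablyConjH L v) mH (ψ s) γH) ∧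
        -- ROW (3), Levi, transfer-shaped (law debt)
        (∃ V ∈ 𝓝 (1 : ((UnitaryGroup.cmDatum L 2 (Matrix.of fun i j : Fin 2 => if i.val + j.val + 1 = 2 then (1 : L) else 0)).Local v × (UnitaryGroup.cmDatum L 1 (Matrix.of fun i j : Fin 1 => if i.val + j.val + 1 = 1 then (1 : L) else 0)).Local v)), ∀ γH ∈ V, IsLocalGRegular L v γH →
        (∃ (y : ((UnitaryGroup.cmDatum L 2 (Matrix.of fun i j : Fin 2 => if i.val + j.val + 1 = 2 then (1 : L) else 0)).Local v × (UnitaryGroup.cmDatum L 1 (Matrix.of fun i j : Fin 1 => if i.val + j.val + 1 = 1 then (1 : L) else 0)).Local v)) (d' : Fin 2 → (UnitaryGroup.LocalRing L v)ˣ),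
            glDiagonal 2 (UnitaryGroup.LocalRing L v) d' = ((y * γH * y⁻¹).1.val : GL (Fin 2) (UnitaryGroup.LocalRing L v))) →
        ∑ᶠ c : ConjClasses ((UnitaryGroup.cmDatum L 3 (Matrix.of fun i j : Fin 3 => if i.val + j.val + 1 = 3 then (1 : L) else 0)).Local v), ((finExplicitCollection L (Matrix.of fun i j : Fin 3 => if i.val + j.val + 1 = 3 then (1 : L) else 0) μ (finExplicitDelta_conj_left_all L (Matrix.of fun i j : Fin 3 => if i.val + j.val + 1 = 3 then (1 : L) else 0) μ) (finExplicitDelta_conj_right_all L (Matrix.of fun i j : Fin 3 => if i.val + j.val + 1 = 3 then (1 : L) else 0) μ)) v).Δ γH (Quotient.out c) * classOrbitalIntegral mG₃ 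
          (Set.indicator {u : ((UnitaryGroup.cmDatum L 3 (Matrix.of fun i j : Fin 3 => if i.val + j.val + 1 = 3 then (1 : L) else 0)).Local v) |
          u ∈ cmLocalIntegralLevel L 3 (Matrix.of fun i j : Fin 3 => if i.val + j.val + 1 = 3 then (1 : L) else 0) v ∧
          (InLevel ϖ (la (dOfPlace L v w)) (wMatrix L w hw u - 1) ∧ InLevel ϖ (lb (dOfPlace L v w)) ((wMatrix L w hw u - 1) * (wMatrix L w hw u - 1)))} (fun _ => (1 : ℂ))) c =
          ∑ s, coef s * stableOrbitalIntegralRel (IsLocalStablyConjH L v) mH (ψ s) γH)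

open scoped Classical in
/-- (H-sq)-S · **`HSideSqTripleS shift Ω N₀ lb A`** — THE H-SIDE TRIPLE OF THE SQUARE-LEVEL PIECE `𝟙{u ∈ K ∣ X² ∈ ϖ^{lb(d)}M₃}` in the closed form of its (K-SGN-sq) law with
amplitude letter `A` — the `hH` binder of ★ p859209 `pieceRowsWild_sqLevel_of_fencedLaw_of_hside shift Ω N₀ lb A` TOKEN FOR TOKEN.  Instance of record `(lb, A) = (mstarOfRecord, amplCs)`.
PAYER (D-1b §3): LH4-p06 (g6) `hSideSq_hFamily_of_rows` (organs: row (2) LH4-p07 (g8) ∕ LH4-p04 (g7) at the sq piece, row (3) LH4-p10 (g5) ★ p859150 reg fibre volume).  NON-VACUITY: as for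
`HSideLevelsTripleS` — rows (2)(3) exclude `ψ = 0` (REF5 R5-277 (iii)).  An H-SIDE IDENTITY — a PROVER TARGET, nothing asserted.
[cite: Rogawski1990, §4.3 (4.3.1) p. 43; §4.9 Prop. 4.9.1 (a)(b) p. 55; §8.1 Prop. 8.1.2 (b) p. 114] [cite: LanglandsShelstad1987, §1.3, §3] [cite: Kottwitz1986BaseChangeUnits, §1 pp. 240–241] -/
def HSideSqTripleS (shift : ℕ → ℕ → ℤ) (Ω : OmegaSchedule) (N₀ lb : ℕ → ℕ) (A : ℕ → ℕ → ℕ → ℕ → ℤ → ℚ) : Prop :=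
    ∀ (L : Type) [Field L] [NumberField L] [IsCMField L]
      {v : HeightOneSpectrum (𝓞 ↥(maximalRealSubfield L))} (w : UnitaryGroup.PlacesOver L v)
      (hw : IsCMField.complexConj L • w.1 = w.1) (_he : v.asIdeal.ramificationIdx' w.1.asIdeal ≠ 1)
      (_h2 : ¬ IsUnit (2 : 𝒪[w.1.adicCompletion L]))
      (ϖ : (w.1.adicCompletion L)) (_hϖ : Valued.v ϖ = WithZero.exp (-1 : ℤ)) (d tE : ℕ) (_hD : IsRamifiedQuadraticDatum (galAdicCompletionMap (L := L) (IsCMField.complexConj L) hw) ϖ d tE)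
      [Fintype (Valued.ResidueField (w.1.adicCompletion L))] (δ : (w.1.adicCompletion L)) (_hδ : (galAdicCompletionMap (L := L) (IsCMField.complexConj L) hw) δ = -δ) (_hδ0 : δ ≠ 0)
      (μ : HeckeCharacter L) (_hμu : μ.IsUnitary)
      (_hμω : ∀ x : ideleGroup ↥(maximalRealSubfield L), μ (AdeleRing.ideleBaseChange ↥(maximalRealSubfield L) L x) = quadraticHeckeCharCM L x)
      [MeasurableSpace ((UnitaryGroup.cmDatum L 3 (Matrix.of fun i j : Fin 3 => if i.val + j.val + 1 = 3 then (1 : L) else 0)).Local v)] [BorelSpace ((UnitaryGroup.cmDatum L 3 (Matrix.of fun i j : Fin 3 => if i.val + j.val + 1 = 3 then (1 : L) else 0)).Local v)]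
      [∀ γ : ((UnitaryGroup.cmDatum L 3 (Matrix.of fun i j : Fin 3 => if i.val + j.val + 1 = 3 then (1 : L) else 0)).Local v), MeasurableSpace (((UnitaryGroup.cmDatum L 3 (Matrix.of fun i j : Fin 3 => if i.val + j.val + 1 = 3 then (1 : L) else 0)).Local v) ⧸ Subgroup.centralizer ({γ} : Set ((UnitaryGroup.cmDatum L 3 (Matrix.of fun i j : Fin 3 => if i.val + j.val + 1 = 3 then (1 : L) else 0)).Local v)))]
      [∀ γ : ((UnitaryGroup.cmDatum L 3 (Matrix.of fun i j : Fin 3 => if i.val + j.val + 1 = 3 then (1 : L) else 0)).Local v), BorelSpace (((UnitaryGroup.cmDatum L 3 (Matrix.of fun i j : Fin 3 => if i.val + j.val + 1 = 3 then (1 : L) else 0)).Local v) ⧸ Subgroup.centralizer ({γ} : Set ((UnitaryGroup.cmDatum L 3 (Matrix.of fun i j : Fin 3 => if i.val + j.val + 1 = 3 then (1 : L) else 0)).Local v)))]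
      [MeasurableSpace ((UnitaryGroup.cmDatum L 2 (Matrix.of fun i j : Fin 2 => if i.val + j.val + 1 = 2 then (1 : L) else 0)).Local v × (UnitaryGroup.cmDatum L 1 (Matrix.of fun i j : Fin 1 => if i.val + j.val + 1 = 1 then (1 : L) else 0)).Local v)] [BorelSpace ((UnitaryGroup.cmDatum L 2 (Matrix.of fun i j : Fin 2 => if i.val + j.val + 1 = 2 then (1 : L) else 0)).Local v × (UnitaryGroup.cmDatum L 1 (Matrix.of fun i j : Fin 1 => if i.val + j.val + 1 = 1 then (1 : L) else 0)).Local v)]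
      [∀ a : ((UnitaryGroup.cmDatum L 2 (Matrix.of fun i j : Fin 2 => if i.val + j.val + 1 = 2 then (1 : L) else 0)).Local v × (UnitaryGroup.cmDatum L 1 (Matrix.of fun i j : Fin 1 => if i.val + j.val + 1 = 1 then (1 : L) else 0)).Local v), MeasurableSpace (((UnitaryGroup.cmDatum L 2 (Matrix.of fun i j : Fin 2 => if i.val + j.val + 1 = 2 then (1 : L) else 0)).Local v × (UnitaryGroup.cmDatum L 1 (Matrix.of fun i j : Fin 1 => if i.val + j.val + 1 = 1 then (1 : L) else 0)).Local v) ⧸ Subgroup.centralizer ({a} : Set ((UnitaryGroup.cmDatum L 2 (Matrix.of fun i j : Fin 2 => if i.val + j.val + 1 = 2 then (1 : L) else 0)).Local v × (UnitaryGroup.cmDatum L 1 (Matrix.of fun i j : Fin 1 => if i.val + j.val + 1 = 1 then (1 : L) else 0)).Local v)))]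
      [∀ a : ((UnitaryGroup.cmDatum L 2 (Matrix.of fun i j : Fin 2 => if i.val + j.val + 1 = 2 then (1 : L) else 0)).Local v × (UnitaryGroup.cmDatum L 1 (Matrix.of fun i j : Fin 1 => if i.val + j.val + 1 = 1 then (1 : L) else 0)).Local v), BorelSpace (((UnitaryGroup.cmDatum L 2 (Matrix.of fun i j : Fin 2 => if i.val + j.val + 1 = 2 then (1 : L) else 0)).Local v × (UnitaryGroup.cmDatum L 1 (Matrix.of fun i j : Fin 1 => if i.val + j.val + 1 = 1 then (1 : L) else 0)).Local v) ⧸ Subgroup.centralizer ({a} : Set ((UnitaryGroup.cmDatum L 2 (Matrix.of fun i j : Fin 2 => if i.val + j.val + 1 = 2 then (1 : L) else 0)).Local v × (UnitaryGroup.cmDatum L 1 (Matrix.of fun i j : Fin 1 => if i.val + j.val + 1 = 1 then (1 : L) else 0)).Local v)))]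
      (νH : Measure ((UnitaryGroup.cmDatum L 2 (Matrix.of fun i j : Fin 2 => if i.val + j.val + 1 = 2 then (1 : L) else 0)).Local v × (UnitaryGroup.cmDatum L 1 (Matrix.of fun i j : Fin 1 => if i.val + j.val + 1 = 1 then (1 : L) else 0)).Local v)) [νH.IsHaarMeasure] [νH.IsMulRightInvariant]
      (νG₃ : Measure ((UnitaryGroup.cmDatum L 3 (Matrix.of fun i j : Fin 3 => if i.val + j.val + 1 = 3 then (1 : L) else 0)).Local v)) [νG₃.IsHaarMeasure] [νG₃.IsMulRightInvariant]
      (mH : OrbitalMeasureFamily ((UnitaryGroup.cmDatum L 2 (Matrix.of fun i j : Fin 2 => if i.val + j.val + 1 = 2 then (1 : L) else 0)).Local v × (UnitaryGroup.cmDatum L 1 (Matrix.of fun i j : Fin 1 => if i.val + j.val + 1 = 1 then (1 : L) else 0)).Local v)) (mG₃ : OrbitalMeasureFamily ((UnitaryGroup.cmDatum L 3 (Matrix.of fun i j : Fin 3 => if i.val + j.val + 1 = 3 then (1 : L) else 0)).Local v))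
      (_hmH : mH.IsCanonical (IsLocalGRegular L v) νH) (_hmG : mG₃.IsCanonical (fun γ => IsRegularElt (γ.val : GL (Fin 3) (UnitaryGroup.LocalRing L v))) νG₃),
      ∃ (r : ℕ) (ψ : Fin r → ((UnitaryGroup.cmDatum L 2 (Matrix.of fun i j : Fin 2 => if i.val + j.val + 1 = 2 then (1 : L) else 0)).Local v × (UnitaryGroup.cmDatum L 1 (Matrix.of fun i j : Fin 1 => if i.val + j.val + 1 = 1 then (1 : L) else 0)).Local v) → ℂ) (_ : ∀ s, IsLocSmooth (ψ s)) (coef : Fin r → ℂ),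
        -- ROW (1): the H-side realises THE κ-SIGNED LEVEL CENSUS OVER THE FOUR FRAMES `Γ_b` times the base transfer factor (no law pre-evaluated)
        (∃ V ∈ 𝓝 (1 : ((UnitaryGroup.cmDatum L 2 (Matrix.of fun i j : Fin 2 => if i.val + j.val + 1 = 2 then (1 : L) else 0)).Local v × (UnitaryGroup.cmDatum L 1 (Matrix.of fun i j : Fin 1 => if i.val + j.val + 1 = 1 then (1 : L) else 0)).Local v)), ∀ γH ∈ V, IsLocalGRegular L v γH →
          ∀ (f : Fin 4 → Fin 3 → (Fin 3 → (w.1.adicCompletion L))) (_hf : IsFourFrameFamily (galAdicCompletionMap (L := L) (IsCMField.complexConj L) hw) f)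
        (a b z : (w.1.adicCompletion L)) (_ha : a * (galAdicCompletionMap (L := L) (IsCMField.complexConj L) hw) a = 1) (_hb : b * (galAdicCompletionMap (L := L) (IsCMField.complexConj L) hw) b = 1) (_hz : z * (galAdicCompletionMap (L := L) (IsCMField.complexConj L) hw) z = 1)
        (_hzγ : z = finGammaTwo L v γH w) (_hra : ((((γH).1.val : GL (Fin 2) (UnitaryGroup.LocalRing L v)).val.map (Pi.evalRingHom (fun w' : UnitaryGroup.PlacesOver L v => w'.1.adicCompletion L) w))).charpoly.IsRoot (z * (a * a))) (_hrb : ((((γH).1.val : GL (Fin 2) (UnitaryGroup.LocalRing L v)).val.map (Pi.evalRingHom (fun w' : UnitaryGroup.PlacesOver L v => w'.1.adicCompletion L) w))).charpoly.IsRoot (z * (b * b)))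
        (_ha1 : Valued.v (a - 1) < Valued.v (2 : (w.1.adicCompletion L))) (_hb1 : Valued.v (b - 1) < Valued.v (2 : (w.1.adicCompletion L)))
        (n₁ n₂ n₃ : ℕ) (_hE : IsElementDatum (galAdicCompletionMap (L := L) (IsCMField.complexConj L) hw) ϖ (N₀ d) (a * a) (b * b) n₁ n₂ n₃)
        (k : ℕ) (_hk : 2 * k + d = n₁ + n₂ + n₃ + 2)
        (Γ : Fin 4 → GL (Fin 3) (w.1.adicCompletion L)) (_hΓ : ∀ b', (Γ b' : Matrix (Fin 3) (Fin 3) (w.1.adicCompletion L)) = frameElt (galAdicCompletionMap (L := L) (IsCMField.complexConj L) hw) f b' (a * a) (b * b))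
        (tb : Fin 4 → ((UnitaryGroup.cmDatum L 3 (Matrix.of fun i j : Fin 3 => if i.val + j.val + 1 = 3 then (1 : L) else 0)).Local v)) (_htb : ∀ b', ((((localNonsplitEquiv (IsCMField.complexConj L) (Matrix.of fun i j : Fin 3 => if i.val + j.val + 1 = 3 then (1 : L) else 0) (IsCMField.complexConj_ne_one L) w hw (tb b') :
              ↥(unitaryGroupOfForm (galAdicCompletionMap (L := L) (IsCMField.complexConj L) hw) (placeForm (Matrix.of fun i j : Fin 3 => if i.val + j.val + 1 = 3 then (1 : L) else 0) w.1))) : GL (Fin 3) (w.1.adicCompletion L)) : Matrix (Fin 3) (Fin 3) (w.1.adicCompletion L))) = z • (Γ b' : Matrix (Fin 3) (Fin 3) (w.1.adicCompletion L)))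
            (i : Fin 3) (B : ℤ), 2 * B = ((![n₁, n₂, n₃] : Fin 3 → ℕ) i : ℤ) - d + 2 - 2 * shift d tE →
            (∀ t' : ((UnitaryGroup.cmDatum L 3 (Matrix.of fun i j : Fin 3 => if i.val + j.val + 1 = 3 then (1 : L) else 0)).Local v), IsLocalNormPair L (Matrix.of fun i j : Fin 3 => if i.val + j.val + 1 = 3 then (1 : L) else 0) v γH t' ↔ ∃ b', ConjClasses.mk t' = ConjClasses.mk (tb b')) →
            (∀ b' : Fin 4, ((finExplicitCollection L (Matrix.of fun i j : Fin 3 => if i.val + j.val + 1 = 3 then (1 : L) else 0) μ (finExplicitDelta_conj_left_all L (Matrix.of fun i j : Fin 3 => if i.val + j.val + 1 = 3 then (1 : L) else 0) μ) (finExplicitDelta_conj_right_all L (Matrix.of fun i j : Fin 3 => if i.val + j.val + 1 = 3 then (1 : L) else 0) μ)) v).Δ γH (tb b') = ((finExplicitCollection L (Matrix.of fun i j : Fin 3 => if i.val + j.val + 1 = 3 then (1 : L) else 0) μ (finExplicitDelta_conj_left_all L (Matrix.of fun i j : Fin 3 => if i.val + j.val + 1 = 3 then (1 : L) else 0) μ)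 (finExplicitDelta_conj_right_all L (Matrix.of fun i j : Fin 3 => if i.val + j.val + 1 = 3 then (1 : L) else 0) μ)) v).Δ γH (tb 0) * (kappaChar i b' : ℂ)) →
            ∑ s, coef s * stableOrbitalIntegralRel (IsLocalStablyConjH L v) mH (ψ s) γH =
              ((finExplicitCollection L (Matrix.of fun i j : Fin 3 => if i.val + j.val + 1 = 3 then (1 : L) else 0) μ (finExplicitDelta_conj_left_all L (Matrix.of fun i j : Fin 3 => if i.val + j.val + 1 = 3 then (1 : L) else 0) μ) (finExplicitDelta_conj_right_all L (Matrix.of fun i j : Fin 3 => if i.val + j.val + 1 = 3 then (1 : L) else 0) μ)) v).Δ γH (tb 0) * ((νG₃ (cmLocalIntegralLevel L 3 (Matrix.of fun i j : Fin 3 => if i.val + j.val + 1 = 3 then (1 : L) else 0) v : Set ((UnitaryGroup.cmDatum L 3 (Matrix.of fun i j : Fin 3 => if i.val + j.val + 1 = 3 then (1 : L) else 0)).Local v))).toReal : ℂ) *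
                (((Ω (w.1.adicCompletion L) (galAdicCompletionMap (L := L) (IsCMField.complexConj L) hw) ϖ d a b i * (baseSign (galAdicCompletionMap (L := L) (IsCMField.complexConj L) hw) i * normSign (galAdicCompletionMap (L := L) (IsCMField.complexConj L) hw) (fPartProd δ ![a, b, 1] i)) : ℤ) : ℂ) *
                  ((A (Fintype.card (Valued.ResidueField (w.1.adicCompletion L))) d tE k B : ℚ) : ℂ))) ∧
        -- ROW (2), type (2), transfer-shaped (law debt)
        (∃ V ∈ 𝓝 (1 : ((UnitaryGroup.cmDatum L 2 (Matrix.of fun i j : Fin 2 => if i.val + j.val + 1 = 2 then (1 : L) else 0)).Local v × (UnitaryGroup.cmDatum L 1 (Matrix.of fun i j : Fin 1 => if i.val + j.val + 1 = 1 then (1 : L) else 0)).Local v)), ∀ γH ∈ V, IsLocalGRegular L v γH →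
        ¬ (∃ x : (w.1.adicCompletion L), (((((γH).1.val : GL (Fin 2) (UnitaryGroup.LocalRing L v)).val.map (Pi.evalRingHom (fun w' : UnitaryGroup.PlacesOver L v => w'.1.adicCompletion L) w))).charpoly).IsRoot x) →
        ∑ᶠ c : ConjClasses ((UnitaryGroup.cmDatum L 3 (Matrix.of fun i j : Fin 3 => if i.val + j.val + 1 = 3 then (1 : L) else 0)).Local v), ((finExplicitCollection L (Matrix.of fun i j : Fin 3 => if i.val + j.val + 1 = 3 then (1 : L) else 0) μ (finExplicitDelta_conj_left_all L (Matrix.of fun i j : Fin 3 => if i.val + j.val + 1 = 3 then (1 : L) else 0) μ) (finExplicitDelta_conj_right_all L (Matrix.of fun i j : Fin 3 => if i.val + j.val + 1 = 3 then (1 : L) else 0) μ)) v).Δ γH (Quotient.out c) * classOrbitalIntegral mG₃ 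
          (Set.indicator {u : ((UnitaryGroup.cmDatum L 3 (Matrix.of fun i j : Fin 3 => if i.val + j.val + 1 = 3 then (1 : L) else 0)).Local v) |
          u ∈ cmLocalIntegralLevel L 3 (Matrix.of fun i j : Fin 3 => if i.val + j.val + 1 = 3 then (1 : L) else 0) v ∧
          InLevel ϖ (lb (dOfPlace L v w)) ((wMatrix L w hw u - 1) * (wMatrix L w hw u - 1))} (fun _ => (1 : ℂ))) c =
          ∑ s, coef s * stableOrbitalIntegralRel (IsLocalStablyConjH L v) mH (ψ s) γH) ∧
        -- ROW (3), Levi, transfer-shaped (law debt)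
        (∃ V ∈ 𝓝 (1 : ((UnitaryGroup.cmDatum L 2 (Matrix.of fun i j : Fin 2 => if i.val + j.val + 1 = 2 then (1 : L) else 0)).Local v × (UnitaryGroup.cmDatum L 1 (Matrix.of fun i j : Fin 1 => if i.val + j.val + 1 = 1 then (1 : L) else 0)).Local v)), ∀ γH ∈ V, IsLocalGRegular L v γH →
        (∃ (y : ((UnitaryGroup.cmDatum L 2 (Matrix.of fun i j : Fin 2 => if i.val + j.val + 1 = 2 then (1 : L) else 0)).Local v × (UnitaryGroup.cmDatum L 1 (Matrix.of fun i j : Fin 1 => if i.val + j.val + 1 = 1 then (1 : L) else 0)).Local v)) (d' : Fin 2 → (UnitaryGroup.LocalRing L v)ˣ),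
            glDiagonal 2 (UnitaryGroup.LocalRing L v) d' = ((y * γH * y⁻¹).1.val : GL (Fin 2) (UnitaryGroup.LocalRing L v))) →
        ∑ᶠ c : ConjClasses ((UnitaryGroup.cmDatum L 3 (Matrix.of fun i j : Fin 3 => if i.val + j.val + 1 = 3 then (1 : L) else 0)).Local v), ((finExplicitCollection L (Matrix.of fun i j : Fin 3 => if i.val + j.val + 1 = 3 then (1 : L) else 0) μ (finExplicitDelta_conj_left_all L (Matrix.of fun i j : Fin 3 => if i.val + j.val + 1 = 3 then (1 : L) else 0) μ) (finExplicitDelta_conj_right_all L (Matrix.of fun i j : Fin 3 => if i.val + j.val + 1 = 3 then (1 : L) else 0) μ)) v).Δ γH (Quotient.out c) * classOrbitalIntegral mG₃ 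
          (Set.indicator {u : ((UnitaryGroup.cmDatum L 3 (Matrix.of fun i j : Fin 3 => if i.val + j.val + 1 = 3 then (1 : L) else 0)).Local v) |
          u ∈ cmLocalIntegralLevel L 3 (Matrix.of fun i j : Fin 3 => if i.val + j.val + 1 = 3 then (1 : L) else 0) v ∧
          InLevel ϖ (lb (dOfPlace L v w)) ((wMatrix L w hw u - 1) * (wMatrix L w hw u - 1))} (fun _ => (1 : ℂ))) c =
          ∑ s, coef s * stableOrbitalIntegralRel (IsLocalStablyConjH L v) mH (ψ s) γH)

/-! ## §6  Ties (`rfl` ∕ `omega` ∕ `decide`): the schedules compose; the small-`d` value tables of the sheets -/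

/-- The record's first-level schedules compose: `laLowOfRecord d + 1 = laHighOfRecord d` (`rfl`; so ★ `pieceRowsWild_shell_of_levels`' two instances and the junction's `(d % 2, d % 2 + 1)`
are literally `(laLowOfRecord, laHighOfRecord)`). [cite: Rogawski1990, §4.9 Prop. 4.9.1 (b) p. 55] -/
theorem laLowOfRecord_succ (d : ℕ) : laLowOfRecord d + 1 = laHighOfRecord d := rfl

/-- `blOfRecord d + 2 = klOfRecord d` for `d ≥ 1` (the `B`-shift is the `k`-shift minus two; `klOfRecord d ≥ 2` always). [cite: Rogawski1990, §4.9 Prop. 4.9.1 (a) p. 55] -/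
theorem blOfRecord_add_two (d : ℕ) : blOfRecord d + 2 = klOfRecord d := by
  unfold blOfRecord klOfRecord; omega

/-- `m* ≤ m_c` at every `d` (the clean shell lies inside the shell of record; (L-T+) v7 `mstarOfRecord_le_mcOfRecord`). [cite: Rogawski1990, §4.9 Prop. 4.9.1 (b) p. 55] -/
theorem mstarOfRecord_le_mcOfRecord (d : ℕ) : mstarOfRecord d ≤ mcOfRecord d := by
  unfold mcOfRecord mstarOfRecord; omega

/-- `depthOfRecord d ≤ n0CleanOfRecord d` for `d ≥ 1` (the clean-law threshold is at least the depth of record). [cite: Rogawski1990, §4.9 Prop. 4.9.1 (a) p. 55] -/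
theorem depthOfRecord_le_n0CleanOfRecord {d : ℕ} (hd : 1 ≤ d) : depthOfRecord d ≤ n0CleanOfRecord d := by
  unfold n0CleanOfRecord mcOfRecord mstarOfRecord depthOfRecord; split_ifs <;> omega

/-- Letters at small `d` (kernel arithmetic): `(cs, kl, bl; mc, sT, n0Clean)` = (1,3,1; 2,1,3), (1,2,0; 4,1,4), (2,3,1; 8,3,7), (2,3,1; 10,3,8), (3,4,2; 14,5,9) at d = 1, …, 5 — on the
fitted range d ≤ 3 the texts `(⌈d∕2⌉, 2 + d%2, d%2)` of SIGSHEET-1b F2∕F3 and TEMPLATE-LAWS §2's `(m_c, s, N₀T)`. [cite: Rogawski1990, §4.9 Prop. 4.9.1 (a)(b) p. 55] -/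
theorem letters_small : (csOfRecord 1, csOfRecord 2, csOfRecord 3, csOfRecord 4, csOfRecord 5) = (1, 1, 2, 2, 3) ∧ (klOfRecord 1, klOfRecord 2, klOfRecord 3, klOfRecord 4, klOfRecord 5) =
    (3, 2, 3, 3, 4) ∧ (blOfRecord 1, blOfRecord 2, blOfRecord 3, blOfRecord 4, blOfRecord 5) = (1, 0, 1, 1, 2) ∧ (mcOfRecord 1, mcOfRecord 2, mcOfRecord 3, mcOfRecord 4, mcOfRecord 5) =
    (2, 4, 8, 10, 14) ∧ (sTOfRecord 1, sTOfRecord 2, sTOfRecord 3, sTOfRecord 4, sTOfRecord 5) = (1, 1, 3, 3, 5) ∧ (n0CleanOfRecord 1, n0CleanOfRecord 2, n0CleanOfRecord 3,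
    n0CleanOfRecord 4, n0CleanOfRecord 5) = (3, 4, 7, 8, 9) := by decide

end Summit.HodgeConjecture.HodgeConjecture.Cruxes.H413.F0P3cDyRamStageOneBDefs

end
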